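import Summits.ResolutionOfSingularities.ResolutionOfSingularities.Theorems.EquisingularLiftEquisingularLiftNatInCarrierE1
import Summits.ResolutionOfSingularities.ResolutionOfSingularities.Theorems.EquisingularLiftEquisingularLiftNatInCarrierCentre
import Summits.ResolutionOfSingularities.ResolutionOfSingularities.Theorems.EquisingularLiftEquisingularLiftNatTangentConeFibre
import HarnessLib

/-!
# [OURS · L1 W4.5(b) · EL♮(3)] `OutwardSectionLift` — rule (R-iii) in divisor currency: the OUTWARD
# (cone-direction, coincident-sheet) section `E_{C′} ∩ St(T̃)` of the exceptional divisor of a curve blow-up is a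
# HorizChainE1 centre — regular, `O`-flat, over the old centre, and ON THE STRICT TRANSFORM (clause (e))

Crux `EquisingularLiftNat` = stmt-ResolutionOfSingularities-20038 (route `EquisingularLift`, chain w45b), child line
EL♮(3) = stmt-ResolutionOfSingularities-20148, registered stub `stub_elnat_three_isolated_nontc` (research residue); helper
`--supports stmt-ResolutionOfSingularities-20148 --as helper` by res-type-034 (res-plan-2 IDLE POOL DEAL #3
2026-08-27T08:45:01Z «W4.5b U3 `OutwardSectionLift` := res-type-034», res-L1-w45b-plan-1 UNCLAIMED-STUB LIST W4.5b
08:44:06Z (2) U3: «the whitelist-(c) device of #42 — a section of the exceptional divisor of a curve blow-up in the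
cone/outward direction is an admissible E1 centre when the transversal type is equimultiple»; spec PREREG-K45d ADDENDUM-1
`7fabfbba0a065ba6` §V1′ (c) / P3′ + CHAIN v7.4.1 `5f83398d7e762ee8` §3; res-L1-w45b-plan-1 HANDOFF item 4: «R-iii; divisor
currency `St(D) ∩ E_C` — stub-1's general form»). OURS: replaces the role of NOTHING in H. Hironaka's manuscript and is NOT a
statement of it; AI-written kernel lemmas of the cell `res-hironaka`, weaker than expert review. No definition is declared.

THE DEVICE (CRUX-PLAN w45b v3.1 rule (R-iii), PREREG-K45d ADDENDUM-1 P3′ / PREREG-K45d-bis «UPSTAIRS»). After the blow-up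
`τ : X' → X` of the relative threefold `X → Spec O` along an `O`-smooth curve `C′ = V(C)` lying on a regular lifted cone
surface `T̃ = V(K)` (`K ≤ C`), the strict transform of the running hypersurface may PERSIST along the curve
`Γ̃ := E_{C′} ∩ St(T̃) = ℙ(N_{C′/T̃}) ⊂ E_{C′} = ℙ(N_{C′/X})` — the section of the exceptional `ℙ¹`-bundle in the direction
of the coincident sheets (transversal type `u·k₁² + …`, the sheets tangent to `T̃ = {k₁ = 0}`). Rule (R-iii): the next
centre IS `Γ̃`, in res-L1-w45b-lead-2's currency the ideal sheaf `St_τ(K) ⊔ E` («`C := St ⊔ E`», T-CARRIER-Δ / R1-IN-CARRIER).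
This file proves the entries of the HorizChainE1 step (p500485 / `natChain_and_isIrreducible_of_horizChainE1`) for it:

* §1 `outwardSection_stepData` (scheme level, `Scheme.{0}`, any base ring `O`) — entries (b) REGULAR, (c) FLAT over
  `Spec O`, (d)-input `τ(supp Γ̃) ⊆ V(C)` and the support formula `supp Γ̃ = St(supp K) ∩ τ⁻¹V(C)`, for the centre written
  `𝓘(St supp K) ⊔ C·𝒪_{X'}` (REDUCED strict transform of the carrier): res-L1-w45b-stub-1's R1-IN-CARRIER
  `inCarrier_stepData_of_le` (p508919) read through its own `inCarrier_eq_vanishingIdeal_sup_comap` — the carrier there is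
  ANY `K ≤ C` with `V(K)` regular of irreducible support, so the lifted cone surface through the curve is an instance, exactly
  as the `O`-plane through a section was (T-ISO-1). Also `support_outwardSection_eq_support_schematic`: the reduced and the
  schematic centre (`strictTransformIdeal τ C K ⊔ C·𝒪_{X'}`, res-type-100 p509910) have the same support
  (`coe_support_strictTransformIdeal_sup_comap`, res-type-097 T-TCONE part 1, …NatTangentConeFibre), so §2 serves both spellings.
* §2 `mem_strictTransformSet_of_outwardSection` (stalk level, any universe) — entry (e) «the special points of the centre lie
  on the new running strict transform»: at a point `x'` of `supp (St_τ(K) ⊔ E)` over `s₀ = τ x'`, with `R = 𝒪_{X,s₀}`,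
  `C_{s₀} = (c₁, …, c_r)` quasi-regular with `R/(c)` a domain, THE CARRIER A COORDINATE HYPERSURFACE `K_{s₀} = (c_{j₀})`,
  the uniformizer `ϖ ∈ 𝔪_R ∖ (c)` with `c mod ϖ` quasi-regular and `(R/ϖ)/(c̄)` a domain, and the running strict transform
  `Y′ = supp K_Y`, `(K_Y)_{s₀} = (ϖ, F)` of COINCIDENT-SHEET type along the carrier: `F ≡ u·c_{j₀}² (mod (c)³ + ϖR)`, `ū ∉ (c̄)`
  — then `x' ∈ closure τ⁻¹(Y′ ∖ V(C))`. Assembly of res-type-100's dictionary-producing stalk theorem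
  `exists_stalk_strictTransformIdeal_sup_comap` (Φ = the linear form `T_{j₀}`; the point of `St(T̃)` over `s₀` is read on a
  chart `j ≠ j₀` with `c_{j₀}/c_j ∈ 𝔔`, since `c_{j₀}/c_{j₀} = 1`) with res-L1-w45b-stub-1's (E-c)
  `mem_strictTransformSet_of_doubledPlaneCone` (p512010). No chart dictionary is left in the hypotheses. The statement is
  uniform in `r`: `r = 2` is the outward section over a curve of a relative threefold, `r = 3` the `O`-line
  `ℓ̃ = E_s ∩ St(Π̃)` of T-ISO-1 (same proof).
* §3 `outwardSection_support_inter_subset_strictTransformSet` — entry (e) AS A SET INCLUSION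
  `supp Γ̃ ∩ X'_sp ⊆ closure τ⁻¹(Y′ ∖ V(C))` for any set `X'_sp` of points (the special fibre) at each of which the §2 normal
  form is available («transversal type uniformly coincident-sheet along the special fibre of the curve» — the text's
  «equimultiple transversal type», cf. PREREG-K45d-bis P′3 «A₁ uniform along Γ₃′»); both centre spellings.
* §4 `image_support_outwardSection_subset` — entry (d) «off-generic» is INHERITED: the outward section lies over `V(C)`, so
  over whatever the curve `C′` lay over (as res-type-100's `image_support_carrierDelta_subset_not_isGenericPoint'` for Δ).
* THE CONVERSE (plan-1 CUTS 08:54:30Z «conversely the section `V(t, ξ − ξ₀)` with `ξ̄₀ ≠ 0` violates E1»: off the outward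
  section a point of `E_{C′}` is off `St(Y′)` when the sheet coefficient is a unit; equality of the special traces
  `supp (St_τ(K_Y) ⊔ E) ∩ X'_sp = supp (St_τ(K) ⊔ E) ∩ X'_sp`) is the sequel `…NatOutwardSectionLiftConverse.lean`.

What is NOT here (honest scope): the identification `Γ̃ ≅ C′` («section»: needs `V(C)` Cartier in `V(K)`) and the downstairs
reading `Γ̃_k = E_{C′,k} ∩ St(T̃_k)` (base change of the blow-up along the `O`-flat centre); the local normal form of §2 at the
special points (coordinates `c`, carrier `c_{j₀}`, `F ≡ u c_{j₀}²`) is the consumer's input, as for stub-1's (E-c).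
References: Liu 2002 Thm. 8.1.19; Stacks 080E, 0804; Görtz–Wedhorn I (13.19); Atiyah–Macdonald 3.15 — through the cited
tree files.
-/

set_option linter.dupNamespace false -- mandated namespace `Summit.<Summit>.<Problem>` of this single-conjunct summit

noncomputable section

open CategoryTheory CategoryTheory.Limits AlgebraicGeometry TopologicalSpace Topology IsLocalRing
open Literature.AlgebraicGeometry.Resolution

namespace Summit.ResolutionOfSingularities.ResolutionOfSingularities.Cruxes.EquisingularLiftNat.Sections

universe u

/-! ## §1 Scheme level: the outward section `𝓘(St supp K) ⊔ C·𝒪_{X'}` is regular, `O`-flat, over `V(C)` -/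

section SchemeLevel

/-- **`OutwardSectionLift`, entries (b) (c) and the support (divisor currency `St(T̃) ∩ E_{C′}`).** Let `q : X → Spec O`,
`τ : X' → X` a proper blow-up along `C` (`X`, `X'` locally Noetherian), and `K ≤ C` ideal sheaves with `V(K)` regular of
irreducible support not inside `supp C` (the lifted cone surface `T̃ ⊇ C′`), `V(C)` regular and `V(C) ↪ X → Spec O` flat (the
`O`-smooth curve `C′`). Then the OUTWARD SECTION centre `Γ̃ := 𝓘(closure τ⁻¹(supp K ∖ supp C)) ⊔ C·𝒪_{X'}` has `V(Γ̃)` REGULAR,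
`V(Γ̃) ↪ X' → X → Spec O` FLAT, `τ(supp Γ̃) ⊆ supp C`, and `supp Γ̃ = closure τ⁻¹(supp K ∖ supp C) ∩ τ⁻¹(supp C)`.
(res-L1-w45b-stub-1's `inCarrier_stepData_of_le` rewritten by `inCarrier_eq_vanishingIdeal_sup_comap`.) [folklore; OURS assembly] -/
theorem outwardSection_stepData (O : Type) [CommRing O] (X X' : Scheme.{0}) [IsLocallyNoetherian X]
    [IsLocallyNoetherian X'] (q : X ⟶ Spec (.of O)) (τ : X' ⟶ X) (K C : X.IdealSheafData) (hKC : K ≤ C)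
    (hτ : IsBlowup τ C) [IsProper τ] (hK : Scheme.IsRegular K.subscheme)
    (hirr : IsIrreducible (K.support : Set X)) (hSC : ¬ (K.support : Set X) ⊆ (C.support : Set X))
    (hC : Scheme.IsRegular C.subscheme) (hCflat : Flat (C.subschemeι ≫ q)) :
    Scheme.IsRegular (Scheme.IdealSheafData.vanishingIdeal
        (⟨closure (τ ⁻¹' ((K.support : Set X) \ (C.support : Set X))), isClosed_closure⟩ : Closeds X') ⊔
          C.comap τ).subscheme ∧
    Flat ((Scheme.IdealSheafData.vanishingIdeal
        (⟨closure (τ ⁻¹' ((K.support : Set X) \ (C.support : Set X))), isClosed_closure⟩ : Closeds X') ⊔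
          C.comap τ).subschemeι ≫ τ ≫ q) ∧
    τ '' ((Scheme.IdealSheafData.vanishingIdeal
        (⟨closure (τ ⁻¹' ((K.support : Set X) \ (C.support : Set X))), isClosed_closure⟩ : Closeds X') ⊔
          C.comap τ).support : Set X') ⊆ (C.support : Set X) ∧
    ((Scheme.IdealSheafData.vanishingIdeal
        (⟨closure (τ ⁻¹' ((K.support : Set X) \ (C.support : Set X))), isClosed_closure⟩ : Closeds X') ⊔
          C.comap τ).support : Set X') =
      closure (τ ⁻¹' ((K.support : Set X) \ (C.support : Set X))) ∩ τ ⁻¹' (C.support : Set X) := by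
  rw [← inCarrier_eq_vanishingIdeal_sup_comap τ C (K.support : Set X)]
  exact inCarrier_stepData_of_le O X X' q τ K C hKC hτ hK hirr hSC hC hCflat

/-- **The two spellings of the outward section have the same support**: for `X'` locally Noetherian and any `τ`, `C`, `K`,
`supp (𝓘(closure τ⁻¹(supp K ∖ supp C)) ⊔ C·𝒪_{X'}) = supp (strictTransformIdeal τ C K ⊔ C·𝒪_{X'})`
(`= closure τ⁻¹(supp K ∖ supp C) ∩ τ⁻¹(supp C)`; reduced: stub-1 `support_inCarrier`, schematic: res-type-097
`coe_support_strictTransformIdeal_sup_comap`). [folklore] -/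
theorem support_outwardSection_eq_support_schematic {X X' : Scheme.{u}} [IsLocallyNoetherian X'] (τ : X' ⟶ X)
    (C K : X.IdealSheafData) :
    ((Scheme.IdealSheafData.vanishingIdeal
        (⟨closure (τ ⁻¹' ((K.support : Set X) \ (C.support : Set X))), isClosed_closure⟩ : Closeds X') ⊔
          C.comap τ).support : Set X') =
      ((strictTransformIdeal τ C K ⊔ C.comap τ).support : Set X') := by
  rw [coe_support_strictTransformIdeal_sup_comap τ C K, Scheme.IdealSheafData.support_sup, Closeds.coe_inf,
    Scheme.IdealSheafData.support_comap, Closeds.coe_preimage, Set.inter_comm]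
  rfl

end SchemeLevel

/-! ## §2 Stalk level: clause (e) — a point of the outward section lies on the new strict transform -/

section StalkLevel

variable {X X' : Scheme.{u}} {τ : X' ⟶ X} {J : X.IdealSheafData}

/-- **`OutwardSectionLift`, entry (e) at a point.** Let `τ : X' → X` be a blow-up along `J` (`IsBlowup`), `X'` locally
Noetherian, `K`, `K_Y` ideal sheaves on `X` (the carrier `T̃ = V(K)` and the running strict transform `Y′ = supp K_Y`), and
`x' ∈ supp (strictTransformIdeal τ J K ⊔ J·𝒪_{X'})` (a point of `E ∩ St(T̃)`). At `R = 𝒪_{X,τ x'}` suppose: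
`J_{τ x'} = (c₁, …, c_r)` with `c` quasi-regular and `R/(c)` a domain; `K_{τ x'} = (c_{j₀})` (the carrier is the coordinate
hypersurface `{c_{j₀} = 0}` through the centre); `ϖ ∈ 𝔪_R ∖ (c)` with `c mod ϖ` quasi-regular and `(R/ϖ)/(c̄)` a domain;
`(K_Y)_{τ x'} = (ϖ, F)` with `F - u·c_{j₀}² ∈ (c)³ + (ϖ)` and `ū ∉ (c̄)` (COINCIDENT SHEETS tangent to the carrier). Then
`x' ∈ closure τ⁻¹(supp K_Y ∖ supp J)`: the outward section lies on the strict transform of `Y′`.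
(`exists_stalk_strictTransformIdeal_sup_comap` with `Φ = T_{j₀}` produces the dictionary `(j, 𝔔, χ, e)` with `c_{j₀}/c_j ∈ 𝔔`,
forcing `j ≠ j₀`; then `mem_strictTransformSet_of_doubledPlaneCone`.) [folklore; OURS assembly] -/
theorem mem_strictTransformSet_of_outwardSection [IsLocallyNoetherian X'] (hτ : IsBlowup τ J)
    (K KY : X.IdealSheafData) (x' : X')
    (hx' : x' ∈ ((strictTransformIdeal τ J K ⊔ J.comap τ).support : Set X'))
    {r : ℕ} (c : Fin r → X.presheaf.stalk (τ x'))
    (hcJ : Ideal.span (Set.range c) = stalkIdeal J (τ x')) (hc : IsQuasiRegular c)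
    [IsDomain (X.presheaf.stalk (τ x') ⧸ Ideal.span (Set.range c))]
    (j₀ : Fin r) (hK : stalkIdeal K (τ x') = Ideal.span {c j₀})
    {ϖ F u : X.presheaf.stalk (τ x')} (hϖ : ϖ ∉ Ideal.span (Set.range c))
    (hϖ𝔪 : ϖ ∈ maximalIdeal (X.presheaf.stalk (τ x')))
    (hcbar : IsQuasiRegular fun l => Ideal.Quotient.mk (Ideal.span {ϖ}) (c l))
    [IsDomain ((X.presheaf.stalk (τ x') ⧸ Ideal.span {ϖ}) ⧸
      Ideal.span (Set.range fun l => Ideal.Quotient.mk (Ideal.span {ϖ}) (c l)))]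
    (hu : Ideal.Quotient.mk (Ideal.span {ϖ}) u ∉
      Ideal.span (Set.range fun l => Ideal.Quotient.mk (Ideal.span {ϖ}) (c l)))
    (hF : F - u * c j₀ ^ 2 ∈ Ideal.span (Set.range c) ^ 3 ⊔ Ideal.span {ϖ})
    (hKY : stalkIdeal KY (τ x') = Ideal.span {ϖ, F}) :
    x' ∈ closure (τ ⁻¹' ((KY.support : Set X) \ (J.support : Set X))) := by
  -- the point lies over the centre
  have hx'J : τ x' ∈ (J.support : Set X) := support_strictTransformIdeal_sup_comap_subset τ J K hx'
  -- the reduction of the linear form `T_{j₀}` modulo `(c)` is non-zero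
  have hΦ : MvPolynomial.map (Ideal.Quotient.mk (Ideal.span (Set.range c)))
      (MvPolynomial.X j₀ : MvPolynomial (Fin r) (X.presheaf.stalk (τ x'))) ≠ 0 := by
    rw [MvPolynomial.map_X]
    exact MvPolynomial.X_ne_zero j₀
  have hKΦ : stalkIdeal K (τ x') =
      Ideal.span {MvPolynomial.eval c (MvPolynomial.X j₀ : MvPolynomial (Fin r) (X.presheaf.stalk (τ x')))} := by
    rw [MvPolynomial.eval_X, hK]
  -- res-type-100's dictionary at `x'`, with the support criterion for `St(K) ⊔ E`
  obtain ⟨j, 𝔔, χ, e, hχ, he, h𝔔, -, -, -, hiff⟩ :=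
    exists_stalk_strictTransformIdeal_sup_comap hτ K x' hx'J c hcJ hc (MvPolynomial.X j₀)
      (MvPolynomial.isHomogeneous_X _ j₀) hΦ hKΦ
  -- `x' ∈ supp (St(K) ⊔ E)` reads `c_{j₀}/c_j ∈ 𝔔`
  have hfrac : blowupAlgebra.frac c j j₀ ∈ 𝔔.asIdeal := by
    have h := hiff.mp hx'
    rwa [MvPolynomial.aeval_X] at h
  -- hence the chart is not the carrier's own chart: `c_{j₀}/c_{j₀} = 1 ∉ 𝔔`
  have hj : j₀ ≠ j := by
    rintro rfl
    apply 𝔔.2.ne_top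
    rw [Ideal.eq_top_iff_one]
    have h1 : blowupAlgebra.frac c j₀ j₀ = 1 := blowupAlgebra.gen_self _ _ _
    rwa [h1] at hfrac
  -- the exceptional equation and the uniformizer lie in `𝔔` (`𝔔 ∩ R = 𝔪_R`)
  have hcj : algebraMap _ (blowupAlgebra (Ideal.span (Set.range c)) (c j)) (c j) ∈ 𝔔.asIdeal := by
    rw [← Ideal.mem_comap, h𝔔]
    have h := (mem_support_iff_stalkIdeal_le J (τ x')).mp hx'J
    rw [← hcJ] at h
    exact h (Ideal.subset_span (Set.mem_range_self j))
  have hϖQ : algebraMap _ (blowupAlgebra (Ideal.span (Set.range c)) (c j)) ϖ ∈ 𝔔.asIdeal := by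
    rw [← Ideal.mem_comap, h𝔔]
    exact hϖ𝔪
  exact mem_strictTransformSet_of_doubledPlaneCone KY x' c hcJ hc hϖ hcbar j₀ hu hF hKY j hj 𝔔 χ e hχ he hfrac hcj hϖQ

/-- The same, for a point of the outward section in the REDUCED spelling `𝓘(closure τ⁻¹(supp K ∖ supp J)) ⊔ J·𝒪_{X'}` of
§1 (equal supports, `support_outwardSection_eq_support_schematic`). [folklore; OURS assembly] -/
theorem mem_strictTransformSet_of_outwardSection' [IsLocallyNoetherian X'] (hτ : IsBlowup τ J)
    (K KY : X.IdealSheafData) (x' : X')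
    (hx' : x' ∈ ((Scheme.IdealSheafData.vanishingIdeal
        (⟨closure (τ ⁻¹' ((K.support : Set X) \ (J.support : Set X))), isClosed_closure⟩ : Closeds X') ⊔
          J.comap τ).support : Set X'))
    {r : ℕ} (c : Fin r → X.presheaf.stalk (τ x'))
    (hcJ : Ideal.span (Set.range c) = stalkIdeal J (τ x')) (hc : IsQuasiRegular c)
    [IsDomain (X.presheaf.stalk (τ x') ⧸ Ideal.span (Set.range c))]
    (j₀ : Fin r) (hK : stalkIdeal K (τ x') = Ideal.span {c j₀})
    {ϖ F u : X.presheaf.stalk (τ x')} (hϖ : ϖ ∉ Ideal.span (Set.range c))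
    (hϖ𝔪 : ϖ ∈ maximalIdeal (X.presheaf.stalk (τ x')))
    (hcbar : IsQuasiRegular fun l => Ideal.Quotient.mk (Ideal.span {ϖ}) (c l))
    [IsDomain ((X.presheaf.stalk (τ x') ⧸ Ideal.span {ϖ}) ⧸
      Ideal.span (Set.range fun l => Ideal.Quotient.mk (Ideal.span {ϖ}) (c l)))]
    (hu : Ideal.Quotient.mk (Ideal.span {ϖ}) u ∉
      Ideal.span (Set.range fun l => Ideal.Quotient.mk (Ideal.span {ϖ}) (c l)))
    (hF : F - u * c j₀ ^ 2 ∈ Ideal.span (Set.range c) ^ 3 ⊔ Ideal.span {ϖ})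
    (hKY : stalkIdeal KY (τ x') = Ideal.span {ϖ, F}) :
    x' ∈ closure (τ ⁻¹' ((KY.support : Set X) \ (J.support : Set X))) := by
  rw [support_outwardSection_eq_support_schematic τ J K] at hx'
  exact mem_strictTransformSet_of_outwardSection hτ K KY x' hx' c hcJ hc j₀ hK hϖ hϖ𝔪 hcbar hu hF hKY

end StalkLevel

/-! ## §3 Clause (e) as a set inclusion along the special fibre -/

section SetLevel

variable {X X' : Scheme.{u}} {τ : X' ⟶ X} {J : X.IdealSheafData}

/-- **`OutwardSectionLift`, entry (e) along the special fibre.** If at every point `x'` of the outward section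
`supp (St_τ(K) ⊔ E)` lying in a set `X'_sp` (the special fibre) the normal form of `mem_strictTransformSet_of_outwardSection`
is available at `τ x'` — centre `(c)` quasi-regular with domain quotient, carrier `K_{τ x'} = (c_{j₀})`, uniformizer `ϖ`,
running strict transform `(K_Y)_{τ x'} = (ϖ, F)` with `F ≡ u·c_{j₀}² (mod (c)³ + ϖ)`, `ū ∉ (c̄)` («coincident-sheet transversal
type, uniformly along the special fibre of the curve») — then
`supp (St_τ(K) ⊔ E) ∩ X'_sp ⊆ closure τ⁻¹(supp K_Y ∖ supp J)`: clause (e) of the HorizChainE1 step for the outward section.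
[folklore; OURS assembly] -/
theorem outwardSection_support_inter_subset_strictTransformSet [IsLocallyNoetherian X'] (hτ : IsBlowup τ J)
    (K KY : X.IdealSheafData) (Xsp : Set X')
    (hdata : ∀ x' ∈ ((strictTransformIdeal τ J K ⊔ J.comap τ).support : Set X') ∩ Xsp,
      ∃ (r : ℕ) (c : Fin r → X.presheaf.stalk (τ x')) (j₀ : Fin r) (ϖ F u : X.presheaf.stalk (τ x')),
        Ideal.span (Set.range c) = stalkIdeal J (τ x') ∧ IsQuasiRegular c ∧
        IsDomain (X.presheaf.stalk (τ x') ⧸ Ideal.span (Set.range c)) ∧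
        stalkIdeal K (τ x') = Ideal.span {c j₀} ∧
        ϖ ∉ Ideal.span (Set.range c) ∧ ϖ ∈ maximalIdeal (X.presheaf.stalk (τ x')) ∧
        (IsQuasiRegular fun l => Ideal.Quotient.mk (Ideal.span {ϖ}) (c l)) ∧
        IsDomain ((X.presheaf.stalk (τ x') ⧸ Ideal.span {ϖ}) ⧸
          Ideal.span (Set.range fun l => Ideal.Quotient.mk (Ideal.span {ϖ}) (c l))) ∧
        Ideal.Quotient.mk (Ideal.span {ϖ}) u ∉
          Ideal.span (Set.range fun l => Ideal.Quotient.mk (Ideal.span {ϖ}) (c l)) ∧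
        F - u * c j₀ ^ 2 ∈ Ideal.span (Set.range c) ^ 3 ⊔ Ideal.span {ϖ} ∧
        stalkIdeal KY (τ x') = Ideal.span {ϖ, F}) :
    ((strictTransformIdeal τ J K ⊔ J.comap τ).support : Set X') ∩ Xsp ⊆
      closure (τ ⁻¹' ((KY.support : Set X) \ (J.support : Set X))) := by
  intro x' hx'
  obtain ⟨r, c, j₀, ϖ, F, u, hcJ, hc, hdom, hK, hϖ, hϖ𝔪, hcbar, hdom', hu, hF, hKY⟩ := hdata x' hx'
  haveI := hdom
  haveI := hdom'
  exact mem_strictTransformSet_of_outwardSection hτ K KY x' hx'.1 c hcJ hc j₀ hK hϖ hϖ𝔪 hcbar hu hF hKY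

/-- The same set inclusion for the REDUCED spelling of §1. [folklore; OURS assembly] -/
theorem outwardSection_support_inter_subset_strictTransformSet' [IsLocallyNoetherian X'] (hτ : IsBlowup τ J)
    (K KY : X.IdealSheafData) (Xsp : Set X')
    (hdata : ∀ x' ∈ ((strictTransformIdeal τ J K ⊔ J.comap τ).support : Set X') ∩ Xsp,
      ∃ (r : ℕ) (c : Fin r → X.presheaf.stalk (τ x')) (j₀ : Fin r) (ϖ F u : X.presheaf.stalk (τ x')),
        Ideal.span (Set.range c) = stalkIdeal J (τ x') ∧ IsQuasiRegular c ∧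
        IsDomain (X.presheaf.stalk (τ x') ⧸ Ideal.span (Set.range c)) ∧
        stalkIdeal K (τ x') = Ideal.span {c j₀} ∧
        ϖ ∉ Ideal.span (Set.range c) ∧ ϖ ∈ maximalIdeal (X.presheaf.stalk (τ x')) ∧
        (IsQuasiRegular fun l => Ideal.Quotient.mk (Ideal.span {ϖ}) (c l)) ∧
        IsDomain ((X.presheaf.stalk (τ x') ⧸ Ideal.span {ϖ}) ⧸
          Ideal.span (Set.range fun l => Ideal.Quotient.mk (Ideal.span {ϖ}) (c l))) ∧
        Ideal.Quotient.mk (Ideal.span {ϖ}) u ∉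
          Ideal.span (Set.range fun l => Ideal.Quotient.mk (Ideal.span {ϖ}) (c l)) ∧
        F - u * c j₀ ^ 2 ∈ Ideal.span (Set.range c) ^ 3 ⊔ Ideal.span {ϖ} ∧
        stalkIdeal KY (τ x') = Ideal.span {ϖ, F}) :
    ((Scheme.IdealSheafData.vanishingIdeal
        (⟨closure (τ ⁻¹' ((K.support : Set X) \ (J.support : Set X))), isClosed_closure⟩ : Closeds X') ⊔
          J.comap τ).support : Set X') ∩ Xsp ⊆
      closure (τ ⁻¹' ((KY.support : Set X) \ (J.support : Set X))) := by
  rw [support_outwardSection_eq_support_schematic τ J K]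
  exact outwardSection_support_inter_subset_strictTransformSet hτ K KY Xsp hdata

end SetLevel

/-! ## §4 Clause (d) «off-generic» is inherited from the blown-up centre -/

section OffGeneric

variable {X X' P : Scheme.{u}} (τ : X' ⟶ X) (σ : X ⟶ P) (J K : X.IdealSheafData)

/-- **`OutwardSectionLift`, entry (d).** The outward section lies over the old centre (`supp (St_τ(K) ⊔ E) ⊆ τ⁻¹ supp J`,
res-type-100 `support_strictTransformIdeal_sup_comap_subset`), so its image in any earlier stage `P` (structure map
`σ : X → P`) lies inside the image of `supp J`; in particular if the blown-up centre lay over non-generic points of `Y`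
(clause (d) of ITS step, `T = {x | ¬ IsGenericPoint x Y}`), so does the outward section. [folklore] -/
theorem image_support_outwardSection_subset (T : Set P) (hJ : σ '' (J.support : Set X) ⊆ T) :
    (τ ≫ σ) '' ((strictTransformIdeal τ J K ⊔ J.comap τ).support : Set X') ⊆ T := by
  rintro _ ⟨x', hx', rfl⟩
  rw [Scheme.Hom.comp_apply]
  exact hJ ⟨τ x', support_strictTransformIdeal_sup_comap_subset τ J K hx', rfl⟩

/-- The same for the REDUCED spelling of §1 (`X'` locally Noetherian, equal supports). [folklore] -/
theorem image_support_outwardSection_subset' [IsLocallyNoetherian X'] (T : Set P) (hJ : σ '' (J.support : Set X) ⊆ T) :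
    (τ ≫ σ) '' ((Scheme.IdealSheafData.vanishingIdeal
        (⟨closure (τ ⁻¹' ((K.support : Set X) \ (J.support : Set X))), isClosed_closure⟩ : Closeds X') ⊔
          J.comap τ).support : Set X') ⊆ T := by
  rw [support_outwardSection_eq_support_schematic τ J K]
  exact image_support_outwardSection_subset τ σ J K T hJ

end OffGeneric

end Summit.ResolutionOfSingularities.ResolutionOfSingularities.Cruxes.EquisingularLiftNat.Sections

end
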